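import Summits.MatrixMultiplication.MatrixMultiplication.Theses.NOFWindowCapacity

/-!
# Route NOFWindowCapacity — `ThesisNeedsEntangled`

We prove the support item `ThesisNeedsEntangled : Thesis → EntangledWindows` of route
NOFWindowCapacity (item stmt-MatrixMultiplication-7278).

Argument (AlmanBlasiok2023 §3.10, linear accounting run backwards).  From `Thesis` at
`ε = η / 3` we get `N ≥ 2`, a finite abelian host `G`, legs `s t u`, and `B` alien-free boxes
partitioning the `N³` matrix-multiplication triples with `B·|G| ≤ N^{2+ε}`.

* pigeonhole: the fullest box holds `c ≥ N³ / B` triples;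
* triangle bound (W3, proved here): in an alien-free box each leg map is injective on the
  ACTIVE pairs (pairs occurring in a cell of the box), so the three pair-projections of the
  cell set have at most `|G|` elements each, and the discrete Loomis–Whitney inequality
  `#S² ≤ #π₁₃(S)·#π₁₂(S)·#π₂₃(S)` gives `c² ≤ |G|³`;
* bookkeeping: `N⁶ ≤ B²c² ≤ B²|G|³` and `B³|G|³ ≤ N^{6+3ε}` give `B ≤ N^{3ε} = N^η`, hence
  `c ≥ N^{3−η}`, while `|G| ≤ B|G| ≤ N^{2+ε} ≤ N^{2+η}`.
-/

-- the tree's namespace `Summit.MatrixMultiplication.MatrixMultiplication.…` repeats a component by design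
set_option linter.dupNamespace false

namespace Summit.MatrixMultiplication.MatrixMultiplication.Theorems

open Finset
open Summit.MatrixMultiplication.MatrixMultiplication.Theses.NOFWindowCapacity

section LoomisWhitney

variable {α β γ : Type*} [DecidableEq α] [DecidableEq β] [DecidableEq γ]

/-- Discrete Loomis–Whitney inequality in three dimensions (triangle-counting form): for a finite
set `S` of triples, `#S² ≤ #π₁₃(S) · #π₁₂(S) · #π₂₃(S)`, where `π₁₂, π₁₃, π₂₃` are the three
coordinate-pair projections.  Proof: Cauchy–Schwarz over the `π₁₂`-fibres, then the pairs of
triples sharing their `π₁₂`-projection inject into `π₁₃(S) × π₂₃(S)`. -/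
theorem card_sq_le_card_proj_mul (S : Finset (α × β × γ)) :
    S.card ^ 2 ≤ (S.image fun x => (x.1, x.2.2)).card * (S.image fun x => (x.1, x.2.1)).card *
      (S.image fun x => (x.2.1, x.2.2)).card := by
  -- the π₁₂ projection and its fibres
  set f : α × β × γ → α × β := fun x => (x.1, x.2.1) with hf
  set SQ := S.image f with hSQ
  set SP := S.image fun x => (x.1, x.2.2) with hSP
  set SR := S.image fun x => (x.2.1, x.2.2) with hSR
  -- pairs of triples with the same π₁₂ projection
  set T : Finset ((α × β × γ) × (α × β × γ)) := (S ×ˢ S).filter fun p => f p.1 = f p.2 with hT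
  have h1 : S.card = ∑ b ∈ SQ, (S.filter fun x => f x = b).card := card_eq_sum_card_image f S
  have h2 : (∑ b ∈ SQ, (S.filter fun x => f x = b).card) ^ 2 ≤
      SQ.card * ∑ b ∈ SQ, (S.filter fun x => f x = b).card ^ 2 := sq_sum_le_card_mul_sum_sq
  have h3 : ∑ b ∈ SQ, (S.filter fun x => f x = b).card ^ 2 = T.card := by
    have hmaps : (T : Set ((α × β × γ) × (α × β × γ))).MapsTo (fun p => f p.1) SQ := by
      intro p hp
      simp only [coe_filter, Set.mem_setOf_eq, mem_product, hT] at hp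
      exact mem_image_of_mem f hp.1.1
    rw [card_eq_sum_card_fiberwise hmaps]
    refine sum_congr rfl fun b _ => ?_
    have hfib : T.filter (fun p => f p.1 = b) =
        (S.filter fun x => f x = b) ×ˢ (S.filter fun x => f x = b) := by
      ext p
      simp only [hT, mem_filter, mem_product]
      constructor
      · rintro ⟨⟨⟨hp1, hp2⟩, h12⟩, hb⟩
        exact ⟨⟨hp1, hb⟩, hp2, h12 ▸ hb⟩
      · rintro ⟨⟨hp1, hb1⟩, hp2, hb2⟩
        exact ⟨⟨⟨hp1, hp2⟩, hb1.trans hb2.symm⟩, hb1⟩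
    rw [hfib, card_product, sq]
  have h4 : T.card ≤ (SP ×ˢ SR).card := by
    refine card_le_card_of_injOn (fun p => ((p.1.1, p.1.2.2), (p.2.2.1, p.2.2.2))) ?_ ?_
    · intro p hp
      simp only [coe_filter, Set.mem_setOf_eq, mem_product, hT] at hp
      simp only [coe_product, Set.mem_prod, mem_coe, hSP, hSR]
      exact ⟨mem_image_of_mem _ hp.1.1, mem_image_of_mem _ hp.1.2⟩
    · rintro ⟨x, y⟩ hp ⟨x', y'⟩ hp' h
      simp only [coe_filter, Set.mem_setOf_eq, mem_product, hT, hf, Prod.mk.injEq] at hp hp'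
      simp only [Prod.mk.injEq] at h
      obtain ⟨⟨hx1, hx3⟩, hy2, hy3⟩ := h
      obtain ⟨-, hxy1, hxy2⟩ := hp
      obtain ⟨-, hxy1', hxy2'⟩ := hp'
      refine Prod.ext (Prod.ext hx1 (Prod.ext ?_ hx3)) (Prod.ext ?_ (Prod.ext hy2 hy3))
      · rw [hxy2, hxy2', hy2]
      · rw [← hxy1, ← hxy1', hx1]
  calc S.card ^ 2 = (∑ b ∈ SQ, (S.filter fun x => f x = b).card) ^ 2 := by rw [h1]
    _ ≤ SQ.card * ∑ b ∈ SQ, (S.filter fun x => f x = b).card ^ 2 := h2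
    _ = SQ.card * T.card := by rw [h3]
    _ ≤ SQ.card * (SP.card * SR.card) :=
        Nat.mul_le_mul_left _ (h4.trans_eq (card_product SP SR))
    _ = SP.card * SQ.card * SR.card := by ring

end LoomisWhitney

section TriangleBound

variable {N : ℕ} {G : Type*} [AddCommGroup G] [Fintype G]

/-- W3 (triangle bound) for one alien-free box of route NOFWindowCapacity: if every triple of `S`
is a cell of the alien-free box `P × Q × R` (legs `s t u` into the abelian host `G`), then
`#S² ≤ |G|³`.  Alien-freeness makes each leg map (`a ↦ u a.2 - s a.1` on output pairs,
`b ↦ t b.2 - s b.1` on X-pairs, `c ↦ u c.2 - t c.1` on Y-pairs) injective on the pairs that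
occur in a cell, so each pair-projection of `S` has at most `|G|` elements; conclude by the
discrete Loomis–Whitney inequality `card_sq_le_card_proj_mul`. -/
theorem card_cells_sq_le_card_cube (s t u : Fin N → G) (P Q R : Finset (Fin N × Fin N))
    (hAF : ∀ a ∈ P, ∀ b ∈ Q, ∀ c ∈ R, (t b.2 - s b.1) + (u c.2 - t c.1) = u a.2 - s a.1 →
      a.1 = b.1 ∧ b.2 = c.1 ∧ a.2 = c.2)
    (S : Finset (Fin N × Fin N × Fin N))
    (hS : ∀ x ∈ S, (x.1, x.2.2) ∈ P ∧ (x.1, x.2.1) ∈ Q ∧ (x.2.1, x.2.2) ∈ R) :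
    S.card ^ 2 ≤ Fintype.card G ^ 3 := by
  -- output pairs: a ↦ u a.2 - s a.1 is injective on the active ones
  have hP : (S.image fun x => (x.1, x.2.2)).card ≤ Fintype.card G := by
    rw [← Finset.card_univ (α := G)]
    refine card_le_card_of_injOn (fun a => u a.2 - s a.1) (fun _ _ => mem_univ _) ?_
    intro a ha a' ha' h
    simp only [coe_image, Set.mem_image, mem_coe] at ha ha'
    obtain ⟨x, hx, rfl⟩ := ha
    obtain ⟨x', hx', rfl⟩ := ha'
    obtain ⟨hxP, -, -⟩ := hS x hx
    obtain ⟨-, hx'Q, hx'R⟩ := hS x' hx'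
    have key := hAF _ hxP _ hx'Q _ hx'R (by simp only at h ⊢; rw [h]; abel)
    exact Prod.ext key.1 key.2.2
  -- X-pairs: b ↦ t b.2 - s b.1 is injective on the active ones
  have hQ : (S.image fun x => (x.1, x.2.1)).card ≤ Fintype.card G := by
    rw [← Finset.card_univ (α := G)]
    refine card_le_card_of_injOn (fun b => t b.2 - s b.1) (fun _ _ => mem_univ _) ?_
    intro b hb b' hb' h
    simp only [coe_image, Set.mem_image, mem_coe] at hb hb'
    obtain ⟨x, hx, rfl⟩ := hb
    obtain ⟨x', hx', rfl⟩ := hb'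
    obtain ⟨hxP, -, hxR⟩ := hS x hx
    obtain ⟨-, hx'Q, -⟩ := hS x' hx'
    have key := hAF _ hxP _ hx'Q _ hxR (by simp only at h ⊢; rw [← h]; abel)
    exact Prod.ext key.1 key.2.1.symm
  -- Y-pairs: c ↦ u c.2 - t c.1 is injective on the active ones
  have hR : (S.image fun x => (x.2.1, x.2.2)).card ≤ Fintype.card G := by
    rw [← Finset.card_univ (α := G)]
    refine card_le_card_of_injOn (fun c => u c.2 - t c.1) (fun _ _ => mem_univ _) ?_
    intro c hc c' hc' h
    simp only [coe_image, Set.mem_image, mem_coe] at hc hc'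
    obtain ⟨x, hx, rfl⟩ := hc
    obtain ⟨x', hx', rfl⟩ := hc'
    obtain ⟨hxP, hxQ, -⟩ := hS x hx
    obtain ⟨-, -, hx'R⟩ := hS x' hx'
    have key := hAF _ hxP _ hxQ _ hx'R (by simp only at h ⊢; rw [← h]; abel)
    exact Prod.ext key.2.1 key.2.2
  calc S.card ^ 2 ≤ (S.image fun x => (x.1, x.2.2)).card * (S.image fun x => (x.1, x.2.1)).card *
        (S.image fun x => (x.2.1, x.2.2)).card := card_sq_le_card_proj_mul S
    _ ≤ Fintype.card G * Fintype.card G * Fintype.card G :=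
        Nat.mul_le_mul (Nat.mul_le_mul hP hQ) hR
    _ = Fintype.card G ^ 3 := by ring

end TriangleBound

/-- **ThesisNeedsEntangled** (route NOFWindowCapacity, item stmt-MatrixMultiplication-7278): the
entanglement horn `Thesis` implies `EntangledWindows`.  From `Thesis` at `ε = η/3` the fullest of
the `B` boxes has `c ≥ N³/B` cells (pigeonhole), the triangle bound gives `c² ≤ |G|³`, and with
`B|G| ≤ N^{2+ε}` this forces `B ≤ N^{η}`, so that box is an alien-free window with `≥ N^{3-η}`
cells in a host of order `|G| ≤ N^{2+η}`. -/
theorem thesisNeedsEntangled_proof : ThesisNeedsEntangled := by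
  unfold ThesisNeedsEntangled Thesis EntangledWindows
  intro hX η hη
  have hε : (0 : ℝ) < η / 3 := by positivity
  obtain ⟨N, hN, G, instG, instF, s, t, u, B, P, Q, R, hAF, hPart, hB⟩ := hX (η / 3) hε
  -- the cell sets of the boxes
  set cells : Fin B → Finset (Fin N × Fin N × Fin N) := fun r =>
    Finset.univ.filter (fun x : Fin N × Fin N × Fin N =>
      (x.1, x.2.2) ∈ P r ∧ (x.1, x.2.1) ∈ Q r ∧ (x.2.1, x.2.2) ∈ R r) with hcells
  -- every matrix-multiplication triple lies in some box
  have hcover : (Finset.univ : Finset (Fin N × Fin N × Fin N)) ⊆ Finset.univ.biUnion cells := by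
    intro x _
    obtain ⟨r, hr⟩ := (hPart x.1 x.2.1 x.2.2).exists
    exact mem_biUnion.2 ⟨r, mem_univ _, by simpa [hcells] using hr⟩
  have hsum : N ^ 3 ≤ ∑ r, (cells r).card := by
    calc N ^ 3 = (Finset.univ : Finset (Fin N × Fin N × Fin N)).card := by
          simp only [card_univ, Fintype.card_prod, Fintype.card_fin]; ring
      _ ≤ (Finset.univ.biUnion cells).card := card_le_card hcover
      _ ≤ ∑ r, (cells r).card := card_biUnion_le
  -- there is a box (N ≥ 2), hence a fullest one
  have hN0 : 0 < N := by omega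
  obtain ⟨r₀, -⟩ := (hPart ⟨0, hN0⟩ ⟨0, hN0⟩ ⟨0, hN0⟩).exists
  obtain ⟨r, -, hrmax⟩ :=
    exists_max_image Finset.univ (fun r => (cells r).card) ⟨r₀, mem_univ _⟩
  have hpig : N ^ 3 ≤ B * (cells r).card := by
    calc N ^ 3 ≤ ∑ r', (cells r').card := hsum
      _ ≤ (Finset.univ : Finset (Fin B)).card • (cells r).card :=
          sum_le_card_nsmul _ _ _ fun r' hr' => hrmax r' hr'
      _ = B * (cells r).card := by simp
  -- triangle bound for the fullest box
  have htri : (cells r).card ^ 2 ≤ Fintype.card G ^ 3 :=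
    card_cells_sq_le_card_cube s t u (P r) (Q r) (R r) (hAF r) (cells r)
      (fun x hx => by simpa [hcells] using hx)
  have hB0 : 0 < B := Fin.pos r
  refine ⟨N, hN, G, instG, instF, s, t, u, P r, Q r, R r, hAF r, ?_, ?_⟩
  · -- the host is small: |G| ≤ B·|G| ≤ N^(2+η/3) ≤ N^(2+η)
    have h1 : (Fintype.card G : ℝ) ≤ ((B * Fintype.card G : ℕ) : ℝ) := by
      exact_mod_cast Nat.le_mul_of_pos_left _ hB0
    have hN1 : (1 : ℝ) ≤ N := by exact_mod_cast (show 1 ≤ N by omega)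
    calc (Fintype.card G : ℝ) ≤ ((B * Fintype.card G : ℕ) : ℝ) := h1
      _ ≤ (N : ℝ) ^ (2 + η / 3) := hB
      _ ≤ (N : ℝ) ^ (2 + η) := Real.rpow_le_rpow_of_exponent_le hN1 (by linarith)
  · -- the fullest box is a near-capacity window: N^(3-η) ≤ #cells
    show (N : ℝ) ^ (3 - η) ≤ ((cells r).card : ℝ)
    have hn : (0 : ℝ) < N := by exact_mod_cast hN0
    set E : ℝ := (N : ℝ) ^ (η / 3) with hE
    have hE0 : 0 < E := Real.rpow_pos_of_pos hn _
    have ha : (B : ℝ) * (Fintype.card G : ℝ) ≤ (N : ℝ) ^ 2 * E := by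
      have := hB
      push_cast at this
      rwa [Real.rpow_add hn, Real.rpow_two] at this
    have hb : (N : ℝ) ^ 3 ≤ (B : ℝ) * ((cells r).card : ℝ) := by exact_mod_cast hpig
    have hc : ((cells r).card : ℝ) ^ 2 ≤ (Fintype.card G : ℝ) ^ 3 := by exact_mod_cast htri
    have h2 : (N : ℝ) ^ 6 ≤ (B : ℝ) ^ 2 * (Fintype.card G : ℝ) ^ 3 :=
      calc (N : ℝ) ^ 6 = ((N : ℝ) ^ 3) ^ 2 := by ring
        _ ≤ ((B : ℝ) * ((cells r).card : ℝ)) ^ 2 := by gcongr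
        _ = (B : ℝ) ^ 2 * ((cells r).card : ℝ) ^ 2 := by ring
        _ ≤ (B : ℝ) ^ 2 * (Fintype.card G : ℝ) ^ 3 := by gcongr
    have h1 : (B : ℝ) ^ 3 * (Fintype.card G : ℝ) ^ 3 ≤ (N : ℝ) ^ 6 * E ^ 3 :=
      calc (B : ℝ) ^ 3 * (Fintype.card G : ℝ) ^ 3 = ((B : ℝ) * (Fintype.card G : ℝ)) ^ 3 := by
            ring
        _ ≤ ((N : ℝ) ^ 2 * E) ^ 3 := by gcongr
        _ = (N : ℝ) ^ 6 * E ^ 3 := by ring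
    have h3 : (B : ℝ) ≤ E ^ 3 := by
      have hn6 : (0 : ℝ) < (N : ℝ) ^ 6 := by positivity
      have key : (N : ℝ) ^ 6 * (B : ℝ) ≤ (N : ℝ) ^ 6 * E ^ 3 :=
        calc (N : ℝ) ^ 6 * (B : ℝ) ≤ (B : ℝ) ^ 2 * (Fintype.card G : ℝ) ^ 3 * (B : ℝ) := by
              gcongr
          _ = (B : ℝ) ^ 3 * (Fintype.card G : ℝ) ^ 3 := by ring
          _ ≤ (N : ℝ) ^ 6 * E ^ 3 := h1
      exact le_of_mul_le_mul_left key hn6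
    have h4 : (N : ℝ) ^ 3 ≤ ((cells r).card : ℝ) * E ^ 3 :=
      calc (N : ℝ) ^ 3 ≤ (B : ℝ) * ((cells r).card : ℝ) := hb
        _ ≤ E ^ 3 * ((cells r).card : ℝ) := by gcongr
        _ = ((cells r).card : ℝ) * E ^ 3 := by ring
    have hE3 : E ^ 3 = (N : ℝ) ^ η := by
      rw [hE, ← Real.rpow_natCast, ← Real.rpow_mul hn.le]
      congr 1
      push_cast
      ring
    rw [Real.rpow_sub hn, ← hE3, div_le_iff₀ (by positivity), Real.rpow_ofNat]
    exact h4

end Summit.MatrixMultiplication.MatrixMultiplication.Theorems
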